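import Summits.QuantumFields.YangMills.Theorems.UnitScaleTiltProp7CovLineGradPointwise
import Summits.QuantumFields.YangMills.Theorems.UnitScaleTiltProp7TrueLinLineBound
import Summits.QuantumFields.YangMills.Theorems.UnitScaleTiltProp7CovCombMeanCentred
import HarnessLib

/-!
# Route `UnitScaleTilt`, crux K1 «MinimiserStabilityRegPr» (stmt-QuantumFields-19200), route-R [RP] at a curved background — THE CURVED N6,
# ROW (R-B), PART 6c (third piece of FILE 3, the one-step gradient transfer): THE COVARIANT GRADIENT OF `LINE_V` AT THE NEXT LEVEL, POINTWISE —
# `‖Ū(y,ν)·LINE_VZ(y+e_ν, μ)·Ū(y,ν)* − LINE_VZ(y, μ)‖ ≤ L^{−d}Σ_rΣ_{s<L}Σ_{t<L}‖(∇^V_νZ)(x_r + se_ν + te_μ, μ)‖ + (curvature)·(masses)`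

Cell `ym3-torus`, D-0154 (3c) R3 twin-width seat `ym-routeR-w2` (W-SEAT MAP pass #3 row M9; architecture «ℓ²-Minkowski over levels, level-local», ★★OWNER g26
ACK 12).  THEOREMS ONLY (0 `def`, 0 `sorry`); `--supports stmt-QuantumFields-19200`, count-neutral.  YM₃ on T³ is a ladder rung (R3), not the Clay problem; nothing here
claims the curved N6 bound, S2, P, the crux or the gap.

THE STEP.  `Ū = avgFun ℰ V` (the next tower level, `corr·axialAvg`, `axialAvg = V([emb y → L steps e_ν])`): (A) replacing `Ū(y,ν)` by the straight transport `S` costs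
`2·dist1(corr)·‖LINE‖ ≤ 4θ·‖LINE‖` (`BlockAveragingEMLProp2.dist1_corr_le_two_mul`, `Prop7TrueLinLineBound.norm_line_le`); (B) per comb index, the frame
`S·V(Γ_i from emb(y+e_ν))` and the frame `V(Γ_i from emb y)·V([x_i → L steps e_ν])` run along words of equal net displacement and length `≤ (d+2)L` each, so differ by
`2(d+2)²L²δ·‖Z_V(segment)‖` (`Prop7TwoWordStokes.norm_conj_holAt_sub_conj_holAt_le`); (C) what is left is the covariant difference of the line sums over `L` steps `e_ν`,
which `Prop7CovLineGradPointwise` telescopes into the line sums of `∇^V_νZ` plus the ladder defect `2L²δ`; (D) the comb average `|I|⁻¹Σ_i` is `L^{−d}Σ_r` (idle permutations).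
* §1 `conj_avg_eq`, `norm_avg_sub_avg_le` (averages of conjugated families), `shiftN_eq_iterate`, `holAt_stair_then_line`, `holAt_line_then_stair`, `netDisp_line_stair`.
* §2 ★★ `norm_covGrad_line_le` — the displayed pointwise inequality.
HONEST SCOPE.  Pointwise; the `ℓ²` count over `(y, μ, ν)` (with ✓∕⧗ `Prop7CovLineGradCount`) and the iteration along the tower are the next files.

References: T. Bałaban, CMP 99 (1985) 75–102 [Balaban1985RegularSpaces] ((1.1) p.76); CMP 98 (1985) 17–51 [Balaban1985Averaging] ((19)–(20) p.21, (58) p.27, (125) p.36);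
CMP 109 (1987) 249–301 [Balaban1987RG1] ((0.4) p.253).
-/

noncomputable section

open scoped BigOperators Matrix.Norms.L2Operator

namespace Summit.QuantumFields.YangMills.Theorems.Prop7CovLineGradFrame

open Literature.MathematicalPhysics.QuantumFieldTheory.Balaban1983to89
open Finset T4Continuum BlockAveraging AveragingRT ExpMeanLog BlockAveragingEMLLinearised BlockAveragingEMLLinearisedBackground BlockAveragingEMLProp2
open B10Eq47AxialChi (shiftN shiftN_succ)
open Summit.QuantumFields.YangMills.Theorems.Prop7HolRatioPerStep (norm_coe_eq_one norm_star_coe_eq_one norm_covWalkSum_le_mass)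
open Summit.QuantumFields.YangMills.Theorems.Prop7LineOfTransportedFamily (holAt_walk_replicate_succ covWalkSum_walk_replicate_true)
open Summit.QuantumFields.YangMills.Theorems.Prop7TwoWordStokes (norm_conj_holAt_sub_conj_holAt_le)
open Summit.QuantumFields.YangMills.Theorems.Prop7CovIterLambdaBound (norm_conj_su_le)
open Summit.QuantumFields.YangMills.Theorems.Prop7CovCombMeanCentred (norm_conj_sub_conj_le_frame)
open Summit.QuantumFields.YangMills.Theorems.Prop7TrueLinLineBound (mass_walk_replicate_true norm_line_le)
open Summit.QuantumFields.YangMills.Theorems.Prop7CovLineGradPointwise (norm_conj_line_sub_le norm_covGrad_lineSum_le)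

variable {P : Params} {n : Type*} [Fintype n] [DecidableEq n] [Nonempty n] {j : ℕ}

/-! ## §1 Letters: averages of conjugated families, shifts, the two frames of a comb index -/

omit [Nonempty n] in
/-- Conjugating an average of conjugated terms: `W·(|I|⁻¹Σ_i A_iX_iA_i*)·W* = |I|⁻¹Σ_i (WA_i)X_i(WA_i)*`. [folklore] -/
theorem conj_avg_eq {ι : Type*} [Fintype ι] (W : Matrix.specialUnitaryGroup n ℂ) (A : ι → Matrix.specialUnitaryGroup n ℂ) (X : ι → Matrix n n ℂ) :
    (W : Matrix n n ℂ) * (((Fintype.card ι : ℂ))⁻¹ • ∑ i, ((A i : Matrix.specialUnitaryGroup n ℂ) : Matrix n n ℂ) * X i * star ((A i : Matrix.specialUnitaryGroup n ℂ) : Matrix n n ℂ))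
        * star (W : Matrix n n ℂ)
      = ((Fintype.card ι : ℂ))⁻¹ • ∑ i, ((W * A i : Matrix.specialUnitaryGroup n ℂ) : Matrix n n ℂ) * X i * star ((W * A i : Matrix.specialUnitaryGroup n ℂ) : Matrix n n ℂ) := by
  rw [Matrix.mul_smul, Matrix.smul_mul, Finset.mul_sum, Finset.sum_mul]
  congr 1
  refine Finset.sum_congr rfl fun i _ => ?_
  rw [Submonoid.coe_mul, star_mul]
  noncomm_ring

omit [Nonempty n] in
/-- The difference of two averages is bounded by the average of the termwise bounds. [folklore] -/
theorem norm_avg_sub_avg_le {ι : Type*} [Fintype ι] [Nonempty ι] (u v : ι → Matrix n n ℂ) (F : ι → ℝ) (h : ∀ i, ‖u i - v i‖ ≤ F i) :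
    ‖((Fintype.card ι : ℂ))⁻¹ • ∑ i, u i - ((Fintype.card ι : ℂ))⁻¹ • ∑ i, v i‖ ≤ ((Fintype.card ι : ℝ))⁻¹ * ∑ i, F i := by
  rw [← smul_sub, ← Finset.sum_sub_distrib, norm_smul, norm_inv, Complex.norm_natCast]
  exact mul_le_mul_of_nonneg_left ((norm_sum_le _ _).trans (Finset.sum_le_sum fun i _ => h i)) (by positivity)

omit [Fintype n] [DecidableEq n] [Nonempty n] in
/-- The tree's recursive `m`-fold shift is the `m`-fold iterate of the unit shift. [folklore] -/
theorem shiftN_eq_iterate (x : Site P j) (μ : Fin P.d) : ∀ m : ℕ, shiftN x μ m = (fun z : Site P j => z.shift μ)^[m] x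
  | 0 => rfl
  | m + 1 => by rw [shiftN_succ, shiftN_eq_iterate x μ m, Function.iterate_succ_apply']

omit [Fintype n] [DecidableEq n] [Nonempty n] in
/-- **FRAME 1**: straight transport to the neighbouring centre, then that block's comb: `V([emb y → L e_ν] ∪ Γ_i(y+e_ν)) = S·V(Γ_i(y+e_ν))`. [cite: Balaban1987RG1, (0.4) p.253] -/
theorem holAt_line_then_stair {G : Type*} [GaugeGroup G] (V : GaugeField P j G) (y : Site P (j + 1)) (ν : Fin P.d) (w : List (Letter P.d)) :
    holAt V (walk (emb y) (List.replicate P.L (ν, true) ++ w))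
      = holAt V (walk (emb y) (List.replicate P.L (ν, true))) * holAt V (walk (emb (y.shift ν)) w) := by
  rw [walk_append, holAt_append, walkEnd_replicate_L]

omit [Fintype n] [DecidableEq n] [Nonempty n] in
/-- **FRAME 2**: this block's comb, then the straight transport from its end: `V(Γ_i(y) ∪ [x_i → L e_ν]) = V(Γ_i(y))·V([x_i → L e_ν])`. [cite: Balaban1987RG1, (0.4) p.253] -/
theorem holAt_stair_then_line {G : Type*} [GaugeGroup G] (V : GaugeField P j G) (x : Site P j) (ν : Fin P.d) (w : List (Letter P.d)) :
    holAt V (walk x (w ++ List.replicate P.L (ν, true))) = holAt V (walk x w) * holAt V (walk (walkEnd x w) (List.replicate P.L (ν, true))) := by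
  rw [walk_append, holAt_append]

omit [Fintype n] [DecidableEq n] [Nonempty n] in
/-- The two frames' words have the same net displacement. [folklore] -/
theorem netDisp_line_stair (ν : Fin P.d) (w : List (Letter P.d)) (κ : Fin P.d) :
    netDisp (List.replicate P.L (ν, true) ++ w) κ = netDisp (w ++ List.replicate P.L (ν, true)) κ := by
  rw [T4ReflectionCone.netDisp_append, T4ReflectionCone.netDisp_append, add_comm]

omit [Fintype n] [DecidableEq n] [Nonempty n] in
/-- The end of the neighbouring block's comb is the `L`-fold `e_ν`-shift of this block's comb end: `x_i(y + e_ν) = x_i(y) + Le_ν`. [cite: Balaban1987RG1, (0.3) p.252] -/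
theorem walkEnd_stair_shift_eq_iterate (y : Site P (j + 1)) (ν : Fin P.d) (σ : Equiv.Perm (Fin P.d)) (r : Fin P.d → Fin P.L) :
    walkEnd (emb (y.shift ν)) (stairWord σ (off r)) = (fun z : Site P j => z.shift ν)^[P.L] (walkEnd (emb y) (stairWord σ (off r))) := by
  rw [walkEnd_stairWord_shift y ν σ σ (off r), shiftN_eq_iterate]

omit [Fintype n] [DecidableEq n] [Nonempty n] in
/-- A staircase of (0.3) has at most `(d+1)·L` letters (crude). [cite: Balaban1987RG1, (0.3) p.252] -/
theorem length_stairWord_le_crude (σ : Equiv.Perm (Fin P.d)) (r : Fin P.d → Fin P.L) : (stairWord σ (off r)).length ≤ (P.d + 1) * P.L := by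
  have hN : ∀ ν, (off r ν).natAbs ≤ (P.L - 1) / 2 := fun ν => by have h := off_bounds r ν; omega
  refine (LatticeWordStokes.length_stairWord_le σ (off r) _ hN).trans ?_
  calc P.d * ((P.L - 1) / 2) ≤ P.d * P.L := Nat.mul_le_mul_left _ (by omega)
    _ ≤ (P.d + 1) * P.L := Nat.mul_le_mul_right _ (by omega)

/-! ## §2 ★★ The covariant gradient of `LINE_V` at the next level, pointwise -/

set_option maxHeartbeats 400000 in
/-- ★★ **THE COVARIANT GRADIENT OF `LINE_V` AT THE NEXT LEVEL, POINTWISE.**  `V` an `SU(N)` background of `T^{(j)}` with `PlaqSmall δ V`; at the coarse bond `(y, ν)` let the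
(0.4) loop variables be within `θ < δ_N`, `θ ≤ 1/6`, of `1`.  Then for every direction `μ` and bond field `Z`,
`‖Ū(y,ν)·LINE_VZ(y+e_ν,μ)·Ū(y,ν)* − LINE_VZ(y,μ)‖ ≤ L^{−d}Σ_rΣ_{s<L}Σ_{t<L} ‖(∇^V_νZ)(x_r+se_ν+te_μ, μ)‖ + 2L²δ·L^{−d}Σ_rΣ_{s<L}Σ_{t<L} ‖Z(x_r+(s+1)e_ν+te_μ, μ)‖
 + (2(d+2)²L²δ + 4θ)·L^{−d}Σ_rΣ_{t<L} ‖Z(x_r(y+e_ν)+te_μ, μ)‖` (`Ū = avgFun ℰ V`, `x_r = blockSite y r`, `(∇^V_νZ)(x,μ) = V(x,ν)Z(x+e_ν,μ)V(x,ν)* − Z(x,μ)`).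
[cite: Balaban1985RegularSpaces, (1.1) p.76; Balaban1985Averaging, (125) p.36; Balaban1987RG1, (0.4) p.253] -/
theorem norm_covGrad_line_le (V : GaugeField P j (Matrix.specialUnitaryGroup n ℂ)) {δ : ℝ} (hδ : 0 ≤ δ) (hV : PlaqSmall δ V)
    (Z : PBond P j → Matrix n n ℂ) (y : Site P (j + 1)) (μ ν : Fin P.d) {θ : ℝ}
    (hθ : ∀ i : Idx P, dist1 (loopHol V ⟨y, ν⟩ i) ≤ θ) (hθN : θ < deltaSU n) (hθ6 : θ ≤ 1 / 6) :
    ‖((avgFun (expMeanLogSU (n := n)) V ⟨y, ν⟩ : Matrix.specialUnitaryGroup n ℂ) : Matrix n n ℂ)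
          * (((Fintype.card (Idx P) : ℂ))⁻¹ • ∑ i : Idx P,
              ((holAt V (walk (emb (y.shift ν)) (stairWord i.2.1 (off i.1))) : Matrix.specialUnitaryGroup n ℂ) : Matrix n n ℂ) *
                covWalkSum V Z (walk (walkEnd (emb (y.shift ν)) (stairWord i.2.1 (off i.1))) (List.replicate P.L (μ, true))) *
              star ((holAt V (walk (emb (y.shift ν)) (stairWord i.2.1 (off i.1))) : Matrix.specialUnitaryGroup n ℂ) : Matrix n n ℂ))
          * star ((avgFun (expMeanLogSU (n := n)) V ⟨y, ν⟩ : Matrix.specialUnitaryGroup n ℂ) : Matrix n n ℂ)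
        - ((Fintype.card (Idx P) : ℂ))⁻¹ • ∑ i : Idx P,
              ((holAt V (walk (emb y) (stairWord i.2.1 (off i.1))) : Matrix.specialUnitaryGroup n ℂ) : Matrix n n ℂ) *
                covWalkSum V Z (walk (walkEnd (emb y) (stairWord i.2.1 (off i.1))) (List.replicate P.L (μ, true))) *
              star ((holAt V (walk (emb y) (stairWord i.2.1 (off i.1))) : Matrix.specialUnitaryGroup n ℂ) : Matrix n n ℂ)‖
      ≤ ((P.L : ℝ) ^ P.d)⁻¹ * ∑ r : Fin P.d → Fin P.L, ∑ s ∈ range P.L, ∑ t ∈ range P.L,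
            ‖((V ⟨(fun z : Site P j => z.shift μ)^[t] ((fun z : Site P j => z.shift ν)^[s] (Site.blockSite y r)), ν⟩ : Matrix.specialUnitaryGroup n ℂ) : Matrix n n ℂ)
                * Z ⟨((fun z : Site P j => z.shift μ)^[t] ((fun z : Site P j => z.shift ν)^[s] (Site.blockSite y r))).shift ν, μ⟩
                * star ((V ⟨(fun z : Site P j => z.shift μ)^[t] ((fun z : Site P j => z.shift ν)^[s] (Site.blockSite y r)), ν⟩ :
                    Matrix.specialUnitaryGroup n ℂ) : Matrix n n ℂ)
              - Z ⟨(fun z : Site P j => z.shift μ)^[t] ((fun z : Site P j => z.shift ν)^[s] (Site.blockSite y r)), μ⟩‖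
        + 2 * (P.L : ℝ) ^ 2 * δ * (((P.L : ℝ) ^ P.d)⁻¹ * ∑ r : Fin P.d → Fin P.L, ∑ s ∈ range P.L, ∑ t ∈ range P.L,
            ‖Z ⟨((fun z : Site P j => z.shift μ)^[t] ((fun z : Site P j => z.shift ν)^[s] (Site.blockSite y r))).shift ν, μ⟩‖)
        + (2 * ((P.d : ℝ) + 2) ^ 2 * (P.L : ℝ) ^ 2 * δ + 4 * θ) * (((P.L : ℝ) ^ P.d)⁻¹ * ∑ r : Fin P.d → Fin P.L, ∑ t ∈ range P.L,
            ‖Z ⟨(fun z : Site P j => z.shift μ)^[t] (Site.blockSite (y.shift ν) r), μ⟩‖) := by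
  have hθ0 : 0 ≤ θ := (GaugeGroup.dist1_nonneg _).trans (hθ (Classical.arbitrary _))
  have hLpos : (0 : ℝ) < (P.L : ℝ) ^ P.d := by have := P.L_pos; positivity
  -- opaque names
  obtain ⟨A, hA⟩ : ∃ A : Idx P → Matrix.specialUnitaryGroup n ℂ, A = fun i => holAt V (walk (emb y) (stairWord i.2.1 (off i.1))) := ⟨_, rfl⟩
  obtain ⟨A', hA'⟩ : ∃ A' : Idx P → Matrix.specialUnitaryGroup n ℂ, A' = fun i => holAt V (walk (emb (y.shift ν)) (stairWord i.2.1 (off i.1))) := ⟨_, rfl⟩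
  obtain ⟨f, hf⟩ : ∃ f : Site P j → Matrix n n ℂ, f = fun x => covWalkSum V Z (walk x (List.replicate P.L (μ, true))) := ⟨_, rfl⟩
  obtain ⟨xs, hxs⟩ : ∃ xs : Idx P → Site P j, xs = fun i => walkEnd (emb y) (stairWord i.2.1 (off i.1)) := ⟨_, rfl⟩
  obtain ⟨S, hS⟩ : ∃ S : Matrix.specialUnitaryGroup n ℂ, S = holAt V (walk (emb y) (List.replicate P.L (ν, true))) := ⟨_, rfl⟩
  obtain ⟨κ, hκ⟩ : ∃ κ : Matrix.specialUnitaryGroup n ℂ, κ = corr (expMeanLogSU (n := n)) V ⟨y, ν⟩ := ⟨_, rfl⟩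
  have hx' : ∀ i : Idx P, walkEnd (emb (y.shift ν)) (stairWord i.2.1 (off i.1)) = (fun z : Site P j => z.shift ν)^[P.L] (xs i) := fun i => by
    rw [hxs]; exact walkEnd_stair_shift_eq_iterate y ν i.2.1 i.1
  -- rewrite the two `LINE`s through the opaque names
  have hL' : (((Fintype.card (Idx P) : ℂ))⁻¹ • ∑ i : Idx P,
        ((holAt V (walk (emb (y.shift ν)) (stairWord i.2.1 (off i.1))) : Matrix.specialUnitaryGroup n ℂ) : Matrix n n ℂ) *
          covWalkSum V Z (walk (walkEnd (emb (y.shift ν)) (stairWord i.2.1 (off i.1))) (List.replicate P.L (μ, true))) *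
        star ((holAt V (walk (emb (y.shift ν)) (stairWord i.2.1 (off i.1))) : Matrix.specialUnitaryGroup n ℂ) : Matrix n n ℂ))
      = ((Fintype.card (Idx P) : ℂ))⁻¹ • ∑ i : Idx P, ((A' i : Matrix.specialUnitaryGroup n ℂ) : Matrix n n ℂ) * f ((fun z : Site P j => z.shift ν)^[P.L] (xs i))
          * star ((A' i : Matrix.specialUnitaryGroup n ℂ) : Matrix n n ℂ) := by
    rw [hA', hf]; exact congrArg _ (Finset.sum_congr rfl fun i _ => by rw [hx' i])
  have hL : (((Fintype.card (Idx P) : ℂ))⁻¹ • ∑ i : Idx P,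
        ((holAt V (walk (emb y) (stairWord i.2.1 (off i.1))) : Matrix.specialUnitaryGroup n ℂ) : Matrix n n ℂ) *
          covWalkSum V Z (walk (walkEnd (emb y) (stairWord i.2.1 (off i.1))) (List.replicate P.L (μ, true))) *
        star ((holAt V (walk (emb y) (stairWord i.2.1 (off i.1))) : Matrix.specialUnitaryGroup n ℂ) : Matrix n n ℂ))
      = ((Fintype.card (Idx P) : ℂ))⁻¹ • ∑ i : Idx P, ((A i : Matrix.specialUnitaryGroup n ℂ) : Matrix n n ℂ) * f (xs i)
          * star ((A i : Matrix.specialUnitaryGroup n ℂ) : Matrix n n ℂ) := by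
    rw [hA, hf, hxs]
  -- the mass bound of the neighbouring `LINE` (for the corr step), taken before rewriting
  have hmass' := norm_line_le V Z ⟨y.shift ν, μ⟩
  rw [hL'] at hmass' ⊢
  rw [hL]
  have hV' : avgFun (expMeanLogSU (n := n)) V ⟨y, ν⟩ = κ * S := by
    rw [hκ, hS, ← axialAvg_eq_holAt_walk V ⟨y, ν⟩]; rfl
  rw [hV']
  -- (A) the corr factor
  set LINE' : Matrix n n ℂ := ((Fintype.card (Idx P) : ℂ))⁻¹ • ∑ i : Idx P, ((A' i : Matrix.specialUnitaryGroup n ℂ) : Matrix n n ℂ)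
      * f ((fun z : Site P j => z.shift ν)^[P.L] (xs i)) * star ((A' i : Matrix.specialUnitaryGroup n ℂ) : Matrix n n ℂ) with hLINE'
  have hAstep : ‖((κ * S : Matrix.specialUnitaryGroup n ℂ) : Matrix n n ℂ) * LINE' * star ((κ * S : Matrix.specialUnitaryGroup n ℂ) : Matrix n n ℂ)
        - (S : Matrix n n ℂ) * LINE' * star (S : Matrix n n ℂ)‖ ≤ 4 * θ * ‖LINE'‖ := by
    have h1 := norm_conj_sub_conj_le_frame (κ * S) S LINE'
    have hκS : ((κ * S : Matrix.specialUnitaryGroup n ℂ) : Matrix n n ℂ) * star (S : Matrix n n ℂ) = (κ : Matrix n n ℂ) := by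
      rw [Submonoid.coe_mul, mul_assoc, Prop7HolRatioPerStep.coe_mul_star_self, mul_one]
    rw [hκS, ← FederbushMean.dist1_SU_eq] at h1
    have hcorr : dist1 κ ≤ 2 * θ := by rw [hκ]; exact dist1_corr_le_two_mul V ⟨y, ν⟩ hθ hθN hθ6
    have h0 : 0 ≤ ‖LINE'‖ := norm_nonneg _
    nlinarith [h1, hcorr]
  -- (B)+(C) per comb index
  have hterm : ∀ i : Idx P,
      ‖((S * A' i : Matrix.specialUnitaryGroup n ℂ) : Matrix n n ℂ) * f ((fun z : Site P j => z.shift ν)^[P.L] (xs i)) * star ((S * A' i : Matrix.specialUnitaryGroup n ℂ) : Matrix n n ℂ)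
          - ((A i : Matrix.specialUnitaryGroup n ℂ) : Matrix n n ℂ) * f (xs i) * star ((A i : Matrix.specialUnitaryGroup n ℂ) : Matrix n n ℂ)‖
        ≤ 2 * ((P.d : ℝ) + 2) ^ 2 * (P.L : ℝ) ^ 2 * δ * ∑ t ∈ range P.L, ‖Z ⟨(fun z : Site P j => z.shift μ)^[t] (Site.blockSite (y.shift ν) i.1), μ⟩‖
          + ∑ s ∈ range P.L, (∑ t ∈ range P.L,
              ‖((V ⟨(fun z : Site P j => z.shift μ)^[t] ((fun z : Site P j => z.shift ν)^[s] (Site.blockSite y i.1)), ν⟩ : Matrix.specialUnitaryGroup n ℂ) : Matrix n n ℂ)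
                  * Z ⟨((fun z : Site P j => z.shift μ)^[t] ((fun z : Site P j => z.shift ν)^[s] (Site.blockSite y i.1))).shift ν, μ⟩
                  * star ((V ⟨(fun z : Site P j => z.shift μ)^[t] ((fun z : Site P j => z.shift ν)^[s] (Site.blockSite y i.1)), ν⟩ :
                      Matrix.specialUnitaryGroup n ℂ) : Matrix n n ℂ)
                - Z ⟨(fun z : Site P j => z.shift μ)^[t] ((fun z : Site P j => z.shift ν)^[s] (Site.blockSite y i.1)), μ⟩‖
            + 2 * (P.L : ℝ) ^ 2 * δ * ∑ t ∈ range P.L,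
              ‖Z ⟨((fun z : Site P j => z.shift μ)^[t] ((fun z : Site P j => z.shift ν)^[s] (Site.blockSite y i.1))).shift ν, μ⟩‖) := by
    intro i
    have hxi : xs i = Site.blockSite y i.1 := by rw [hxs]; exact walkEnd_emb_stairWord_eq_blockSite y i.2.1 i.1
    -- the two frames as holonomies of two words from `emb y`
    set T : Matrix.specialUnitaryGroup n ℂ := holAt V (walk (xs i) (List.replicate P.L (ν, true))) with hT
    have h1 : S * A' i = holAt V (walk (emb y) (List.replicate P.L (ν, true) ++ stairWord i.2.1 (off i.1))) := by
      rw [hS, hA', holAt_line_then_stair]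
    have h2 : A i * T = holAt V (walk (emb y) (stairWord i.2.1 (off i.1) ++ List.replicate P.L (ν, true))) := by
      rw [hA, hT, hxs, holAt_stair_then_line]
    set X : Matrix n n ℂ := f ((fun z : Site P j => z.shift ν)^[P.L] (xs i)) with hX
    have hstokes := norm_conj_holAt_sub_conj_holAt_le V hδ hV (emb y) (List.replicate P.L (ν, true) ++ stairWord i.2.1 (off i.1))
      (stairWord i.2.1 (off i.1) ++ List.replicate P.L (ν, true)) (netDisp_line_stair ν _) X
    rw [← h1, ← h2] at hstokes
    have hlen : (((List.replicate P.L (ν, true) ++ stairWord i.2.1 (off i.1)).length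
        + (stairWord i.2.1 (off i.1) ++ List.replicate P.L (ν, true)).length : ℕ) : ℝ) ≤ 2 * (((P.d : ℝ) + 2) * P.L) := by
      have hs := length_stairWord_le_crude (P := P) i.2.1 i.1
      have : (List.replicate P.L (ν, true) ++ stairWord i.2.1 (off i.1)).length + (stairWord i.2.1 (off i.1) ++ List.replicate P.L (ν, true)).length
          ≤ 2 * ((P.d + 2) * P.L) := by
        simp only [List.length_append, List.length_replicate]; nlinarith
      exact_mod_cast this
    have hframe : ‖((S * A' i : Matrix.specialUnitaryGroup n ℂ) : Matrix n n ℂ) * X * star ((S * A' i : Matrix.specialUnitaryGroup n ℂ) : Matrix n n ℂ)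
          - ((A i * T : Matrix.specialUnitaryGroup n ℂ) : Matrix n n ℂ) * X * star ((A i * T : Matrix.specialUnitaryGroup n ℂ) : Matrix n n ℂ)‖
        ≤ 2 * ((P.d : ℝ) + 2) ^ 2 * (P.L : ℝ) ^ 2 * δ * ‖X‖ := by
      refine hstokes.trans ?_
      have h0 : (0 : ℝ) ≤ (((List.replicate P.L (ν, true) ++ stairWord i.2.1 (off i.1)).length
          + (stairWord i.2.1 (off i.1) ++ List.replicate P.L (ν, true)).length : ℕ) : ℝ) := Nat.cast_nonneg _
      have hsq := mul_le_mul hlen hlen h0 (by positivity)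
      have hX0 : 0 ≤ ‖X‖ := norm_nonneg _
      have : ((((List.replicate P.L (ν, true) ++ stairWord i.2.1 (off i.1)).length
          + (stairWord i.2.1 (off i.1) ++ List.replicate P.L (ν, true)).length : ℕ) : ℝ)) ^ 2 / 2 * δ
          ≤ 2 * ((P.d : ℝ) + 2) ^ 2 * (P.L : ℝ) ^ 2 * δ := by
        refine mul_le_mul_of_nonneg_right ?_ hδ
        nlinarith
      exact mul_le_mul_of_nonneg_right this hX0
    -- the mass of the segment
    have hXmass : ‖X‖ ≤ ∑ t ∈ range P.L, ‖Z ⟨(fun z : Site P j => z.shift μ)^[t] (Site.blockSite (y.shift ν) i.1), μ⟩‖ := by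
      rw [hX, hf, ← hx' i, walkEnd_emb_stairWord_eq_blockSite]
      simp only []
      rw [← mass_walk_replicate_true Z μ P.L (Site.blockSite (y.shift ν) i.1)]
      exact norm_covWalkSum_le_mass V Z _
    -- the covariant difference along the transverse line
    have hline : ‖((A i * T : Matrix.specialUnitaryGroup n ℂ) : Matrix n n ℂ) * X * star ((A i * T : Matrix.specialUnitaryGroup n ℂ) : Matrix n n ℂ)
          - ((A i : Matrix.specialUnitaryGroup n ℂ) : Matrix n n ℂ) * f (xs i) * star ((A i : Matrix.specialUnitaryGroup n ℂ) : Matrix n n ℂ)‖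
        ≤ ∑ s ∈ range P.L, ‖((V ⟨(fun z : Site P j => z.shift ν)^[s] (xs i), ν⟩ : Matrix.specialUnitaryGroup n ℂ) : Matrix n n ℂ)
              * f ((fun z : Site P j => z.shift ν)^[s + 1] (xs i))
              * star ((V ⟨(fun z : Site P j => z.shift ν)^[s] (xs i), ν⟩ : Matrix.specialUnitaryGroup n ℂ) : Matrix n n ℂ)
            - f ((fun z : Site P j => z.shift ν)^[s] (xs i))‖ := by
      have hid : ((A i * T : Matrix.specialUnitaryGroup n ℂ) : Matrix n n ℂ) * X * star ((A i * T : Matrix.specialUnitaryGroup n ℂ) : Matrix n n ℂ)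
            - ((A i : Matrix.specialUnitaryGroup n ℂ) : Matrix n n ℂ) * f (xs i) * star ((A i : Matrix.specialUnitaryGroup n ℂ) : Matrix n n ℂ)
          = ((A i : Matrix.specialUnitaryGroup n ℂ) : Matrix n n ℂ)
            * (((T : Matrix.specialUnitaryGroup n ℂ) : Matrix n n ℂ) * X * star ((T : Matrix.specialUnitaryGroup n ℂ) : Matrix n n ℂ) - f (xs i))
            * star ((A i : Matrix.specialUnitaryGroup n ℂ) : Matrix n n ℂ) := by
        rw [Submonoid.coe_mul, star_mul]; noncomm_ring
      rw [hid]
      refine (norm_conj_su_le _ _).trans ?_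
      rw [hT, hX]
      exact norm_conj_line_sub_le V f ν P.L (xs i)
    have hgrad : ∀ s ∈ range P.L,
        ‖((V ⟨(fun z : Site P j => z.shift ν)^[s] (xs i), ν⟩ : Matrix.specialUnitaryGroup n ℂ) : Matrix n n ℂ)
            * f ((fun z : Site P j => z.shift ν)^[s + 1] (xs i))
            * star ((V ⟨(fun z : Site P j => z.shift ν)^[s] (xs i), ν⟩ : Matrix.specialUnitaryGroup n ℂ) : Matrix n n ℂ)
          - f ((fun z : Site P j => z.shift ν)^[s] (xs i))‖
          ≤ ∑ t ∈ range P.L,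
              ‖((V ⟨(fun z : Site P j => z.shift μ)^[t] ((fun z : Site P j => z.shift ν)^[s] (Site.blockSite y i.1)), ν⟩ : Matrix.specialUnitaryGroup n ℂ) : Matrix n n ℂ)
                  * Z ⟨((fun z : Site P j => z.shift μ)^[t] ((fun z : Site P j => z.shift ν)^[s] (Site.blockSite y i.1))).shift ν, μ⟩
                  * star ((V ⟨(fun z : Site P j => z.shift μ)^[t] ((fun z : Site P j => z.shift ν)^[s] (Site.blockSite y i.1)), ν⟩ :
                      Matrix.specialUnitaryGroup n ℂ) : Matrix n n ℂ)
                - Z ⟨(fun z : Site P j => z.shift μ)^[t] ((fun z : Site P j => z.shift ν)^[s] (Site.blockSite y i.1)), μ⟩‖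
            + 2 * (P.L : ℝ) ^ 2 * δ * ∑ t ∈ range P.L,
              ‖Z ⟨((fun z : Site P j => z.shift μ)^[t] ((fun z : Site P j => z.shift ν)^[s] (Site.blockSite y i.1))).shift ν, μ⟩‖ := by
      intro s _
      rw [Function.iterate_succ_apply', hf, hxi]
      exact norm_covGrad_lineSum_le V hδ hV Z μ ν P.L _
    calc _ ≤ ‖((S * A' i : Matrix.specialUnitaryGroup n ℂ) : Matrix n n ℂ) * X * star ((S * A' i : Matrix.specialUnitaryGroup n ℂ) : Matrix n n ℂ)
              - ((A i * T : Matrix.specialUnitaryGroup n ℂ) : Matrix n n ℂ) * X * star ((A i * T : Matrix.specialUnitaryGroup n ℂ) : Matrix n n ℂ)‖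
            + ‖((A i * T : Matrix.specialUnitaryGroup n ℂ) : Matrix n n ℂ) * X * star ((A i * T : Matrix.specialUnitaryGroup n ℂ) : Matrix n n ℂ)
              - ((A i : Matrix.specialUnitaryGroup n ℂ) : Matrix n n ℂ) * f (xs i) * star ((A i : Matrix.specialUnitaryGroup n ℂ) : Matrix n n ℂ)‖ :=
          norm_sub_le_norm_sub_add_norm_sub _ _ _
      _ ≤ 2 * ((P.d : ℝ) + 2) ^ 2 * (P.L : ℝ) ^ 2 * δ * ‖X‖
            + ∑ s ∈ range P.L, ‖((V ⟨(fun z : Site P j => z.shift ν)^[s] (xs i), ν⟩ : Matrix.specialUnitaryGroup n ℂ) : Matrix n n ℂ)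
              * f ((fun z : Site P j => z.shift ν)^[s + 1] (xs i))
              * star ((V ⟨(fun z : Site P j => z.shift ν)^[s] (xs i), ν⟩ : Matrix.specialUnitaryGroup n ℂ) : Matrix n n ℂ)
            - f ((fun z : Site P j => z.shift ν)^[s] (xs i))‖ := add_le_add hframe hline
      _ ≤ _ := by
          refine add_le_add (mul_le_mul_of_nonneg_left hXmass (by positivity)) (Finset.sum_le_sum hgrad)
  -- (D) average over the comb indices; the permutation indices are idle
  have hBC := norm_avg_sub_avg_le
    (fun i : Idx P => ((S * A' i : Matrix.specialUnitaryGroup n ℂ) : Matrix n n ℂ) * f ((fun z : Site P j => z.shift ν)^[P.L] (xs i))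
      * star ((S * A' i : Matrix.specialUnitaryGroup n ℂ) : Matrix n n ℂ))
    (fun i : Idx P => ((A i : Matrix.specialUnitaryGroup n ℂ) : Matrix n n ℂ) * f (xs i) * star ((A i : Matrix.specialUnitaryGroup n ℂ) : Matrix n n ℂ))
    _ hterm
  rw [← conj_avg_eq S A'] at hBC
  -- the permutation indices are idle: `|I|⁻¹Σ_i F(r_i) = L^{−d}Σ_r F(r)`
  have havg : ∀ F : (Fin P.d → Fin P.L) → ℝ, ((Fintype.card (Idx P) : ℝ))⁻¹ * ∑ i : Idx P, F i.1 = ((P.L : ℝ) ^ P.d)⁻¹ * ∑ r : Fin P.d → Fin P.L, F r := by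
    intro F
    rw [sum_idx_of_fst F, card_idx, nsmul_eq_mul]
    have hSd : (0 : ℝ) < (Fintype.card (Equiv.Perm (Fin P.d)) : ℝ) := by exact_mod_cast Fintype.card_pos
    push_cast
    field_simp
  have hBC' := hBC.trans (le_of_eq (havg (fun r : Fin P.d → Fin P.L =>
      2 * ((P.d : ℝ) + 2) ^ 2 * (P.L : ℝ) ^ 2 * δ * ∑ t ∈ range P.L, ‖Z ⟨(fun z : Site P j => z.shift μ)^[t] (Site.blockSite (y.shift ν) r), μ⟩‖
          + ∑ s ∈ range P.L, (∑ t ∈ range P.L,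
              ‖((V ⟨(fun z : Site P j => z.shift μ)^[t] ((fun z : Site P j => z.shift ν)^[s] (Site.blockSite y r)), ν⟩ : Matrix.specialUnitaryGroup n ℂ) : Matrix n n ℂ)
                  * Z ⟨((fun z : Site P j => z.shift μ)^[t] ((fun z : Site P j => z.shift ν)^[s] (Site.blockSite y r))).shift ν, μ⟩
                  * star ((V ⟨(fun z : Site P j => z.shift μ)^[t] ((fun z : Site P j => z.shift ν)^[s] (Site.blockSite y r)), ν⟩ :
                      Matrix.specialUnitaryGroup n ℂ) : Matrix n n ℂ)
                - Z ⟨(fun z : Site P j => z.shift μ)^[t] ((fun z : Site P j => z.shift ν)^[s] (Site.blockSite y r)), μ⟩‖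
            + 2 * (P.L : ℝ) ^ 2 * δ * ∑ t ∈ range P.L,
              ‖Z ⟨((fun z : Site P j => z.shift μ)^[t] ((fun z : Site P j => z.shift ν)^[s] (Site.blockSite y r))).shift ν, μ⟩‖))))
  -- assemble with (A)
  have hmassL : ‖LINE'‖ ≤ ((P.L : ℝ) ^ P.d)⁻¹ * ∑ r : Fin P.d → Fin P.L, ∑ t ∈ range P.L,
      ‖Z ⟨(fun z : Site P j => z.shift μ)^[t] (Site.blockSite (y.shift ν) r), μ⟩‖ := hmass'
  calc _ ≤ ‖((κ * S : Matrix.specialUnitaryGroup n ℂ) : Matrix n n ℂ) * LINE' * star ((κ * S : Matrix.specialUnitaryGroup n ℂ) : Matrix n n ℂ)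
            - (S : Matrix n n ℂ) * LINE' * star (S : Matrix n n ℂ)‖
          + ‖(S : Matrix n n ℂ) * LINE' * star (S : Matrix n n ℂ)
            - ((Fintype.card (Idx P) : ℂ))⁻¹ • ∑ i : Idx P, ((A i : Matrix.specialUnitaryGroup n ℂ) : Matrix n n ℂ) * f (xs i)
                * star ((A i : Matrix.specialUnitaryGroup n ℂ) : Matrix n n ℂ)‖ := norm_sub_le_norm_sub_add_norm_sub _ _ _
    _ ≤ 4 * θ * ‖LINE'‖ + ((P.L : ℝ) ^ P.d)⁻¹ * ∑ r : Fin P.d → Fin P.L,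
          (2 * ((P.d : ℝ) + 2) ^ 2 * (P.L : ℝ) ^ 2 * δ * ∑ t ∈ range P.L, ‖Z ⟨(fun z : Site P j => z.shift μ)^[t] (Site.blockSite (y.shift ν) r), μ⟩‖
          + ∑ s ∈ range P.L, (∑ t ∈ range P.L,
              ‖((V ⟨(fun z : Site P j => z.shift μ)^[t] ((fun z : Site P j => z.shift ν)^[s] (Site.blockSite y r)), ν⟩ : Matrix.specialUnitaryGroup n ℂ) : Matrix n n ℂ)
                  * Z ⟨((fun z : Site P j => z.shift μ)^[t] ((fun z : Site P j => z.shift ν)^[s] (Site.blockSite y r))).shift ν, μ⟩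
                  * star ((V ⟨(fun z : Site P j => z.shift μ)^[t] ((fun z : Site P j => z.shift ν)^[s] (Site.blockSite y r)), ν⟩ :
                      Matrix.specialUnitaryGroup n ℂ) : Matrix n n ℂ)
                - Z ⟨(fun z : Site P j => z.shift μ)^[t] ((fun z : Site P j => z.shift ν)^[s] (Site.blockSite y r)), μ⟩‖
            + 2 * (P.L : ℝ) ^ 2 * δ * ∑ t ∈ range P.L,
              ‖Z ⟨((fun z : Site P j => z.shift μ)^[t] ((fun z : Site P j => z.shift ν)^[s] (Site.blockSite y r))).shift ν, μ⟩‖)) :=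
        add_le_add hAstep hBC'
    _ ≤ _ := by
        rw [Finset.sum_add_distrib, ← Finset.mul_sum, mul_add]
        simp only [Finset.sum_add_distrib, ← Finset.mul_sum]
        have h4 : 0 ≤ 4 * θ := by positivity
        nlinarith [mul_le_mul_of_nonneg_left hmassL h4, hLpos]

end Summit.QuantumFields.YangMills.Theorems.Prop7CovLineGradFrame

end
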